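import Summits.AnomalousDissipation.AnomalousDissipation.Theorems.SolenoidalFractalHomogenisationLagrangianStepOneLevelScales
import Summits.AnomalousDissipation.AnomalousDissipation.Theorems.SolenoidalFractalHomogenisationPermissibleFractalCarrierTime
import Summits.AnomalousDissipation.AnomalousDissipation.Theorems.SolenoidalFractalHomogenisationPermissibleFractalCarrierRegular
import Summits.AnomalousDissipation.AnomalousDissipation.Theorems.SolenoidalFractalHomogenisationLagrangianStepLedgerReal
import HarnessLib

/-!
# K1L_D (stmt-AnomalousDissipation-27980), stub S23″ `stub_windowDefectL`: the TRIM LEVEL `Lc` and its export inequality (first conjunct of S23″)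
# (helper; `--supports … --as helper`)

S23″ (v3-cut-2, `Cruxes/LagrangianRenormalisationStep/OneLevelSplitSketch.lean` rev6) asks its holder to CHOOSE, for `m ≥ m⋆(R,E)`, a trim level
`Lc : ℕ` with `R ≤ Cτ·ρ^στ·Lc²·(1 − e^{−4π²·kbar m·lo})` (`ρ = N m / N (m+1)`), so that the composition's datum trimming costs `≤ ρ^στ × drop_v`.
This file proves the parameter bookkeeping behind the lead's choice `Lc := ⌊ρ^{1/64}·N(m+1)·cellVisc(m+1)/√c⌋₊` with `Cτ = 4`, `στ = 1/16`, from the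
TYPED hypotheses only (`LPermissible`: Taylor recursion, strain clause; template (T3)–(T5); `N_m² ≤ N_{m+1}`):
* `cellVisc_mul_a_ge` — `cellVisc(m+1)·a(m+1) ≥ (a 1·M·W.period/θ₀)·ρ^{−1/8}` for `m ≥ 1` (period = M·W.period/(ν a), (T5), strain ≤ θ ≤ θ₀ρ^{1/16});
* `kbar_ge_gain_div` — `kbar m ≥ kbar (m+1)·gain/cellVisc(m+1)²` (Taylor recursion);
* `kbar_mul_N_sq` — `kbar m·N m² = a m·cellVisc m` (the ratio facts `ρ_m ≤ 1/N m ≤ 2^{−m}` are k3l g4's `rho_le_inv_N` /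
  `rho_le_half_pow` in `…TemplateAsymptotics`; here only `two_pow_le_N` is used).
The export itself (`trimLevel_export`) is assembled from these.  Infrastructure for rung F-D1.A0; NOT a proof of the crux or of anomalous dissipation.
-/

set_option linter.dupNamespace false

namespace Summit.AnomalousDissipation.AnomalousDissipation.Theorems.SolenoidalFractalHomogenisation.LagrangianStep

open Literature.Analysis Literature.Analysis.FluidPDE Literature.Analysis.FluidPDE.LatticeShear
open Summit.AnomalousDissipation.AnomalousDissipation.Theorems.SolenoidalFractalHomogenisation.LagrangianRenormalisationStep (cellVisc_pos')
open Summit.AnomalousDissipation.AnomalousDissipation.Theorems.SolenoidalFractalHomogenisation.PermissibleCarrier (period_pos two_pow_le_N)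

variable {k : ℕ}

/-- `kbar m · N m² = a m · cellVisc m`. -/
theorem kbar_mul_N_sq (D : FractalCarrierData k) (m : ℕ) : D.kbar m * (D.N m : ℝ) ^ 2 = D.a m * D.cellVisc m := by
  have hN : (D.N m : ℝ) ≠ 0 := by have := D.N_pos m; positivity
  rw [kbar_eq_a_mul]
  field_simp

/-- Taylor recursion, lower form: `kbar (m+1) · gain / cellVisc (m+1)² ≤ kbar m`. -/
theorem kbar_ge_gain_div (D : FractalCarrierData k) (hP : D.Permissible) (m : ℕ) :
    D.kbar (m + 1) * (D.gain / D.cellVisc (m + 1) ^ 2) ≤ D.kbar m := by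
  rw [kbar_eq_kbar_succ_mul D hP m]
  have := D.kbar_pos (m + 1)
  nlinarith

/-- **The level-`(m+1)` Reynolds-like product is large**: `cellVisc (m+1) · a (m+1) ≥ (a 1 · M · W.period / θ₀) · ρ^{−1/8}` for `m ≥ 1`, from the
period formula, (T5) `ρ^{−1/16}·physPeriod ≤ refresh`, the strain clause `(Σ_{i≤m} a i)·refresh(m+1) ≤ θ(m+1)` and (T4) `θ(m+1) ≤ θ₀ ρ^{1/16}`
(stated with `n := N(m+1)/N m = ρ^{−1}` as in the registered template). -/
theorem cellVisc_mul_a_ge (E : LagrangianLatticeCarrier k) {W : LatticeWord k} {M : ℝ} {hM : 0 < M} (hW : E.design = W.stretch M hM)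
    (hL : E.LPermissible) {θ₀ : ℝ} (hθ₀ : 0 < θ₀)
    (hT4 : ∀ m, E.θ (m + 1) * ((E.N (m + 1) : ℝ) / E.N m) ^ (1 / 16 : ℝ) ≤ θ₀)
    (hT5 : ∀ m, ((E.N (m + 1) : ℝ) / E.N m) ^ (1 / 16 : ℝ) * E.physPeriod (m + 1) ≤ E.refresh (m + 1))
    {m : ℕ} (hm : 1 ≤ m) :
    (E.a 1 * (M * W.period) / θ₀) * ((E.N (m + 1) : ℝ) / E.N m) ^ (1 / 8 : ℝ) ≤ E.cellVisc (m + 1) * E.a (m + 1) := by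
  -- positivity
  have hν : 0 < E.cellVisc (m + 1) := cellVisc_pos' E.toFractalCarrierData (m + 1)
  have ha : 0 < E.a (m + 1) := E.a_pos (m + 1)
  have ha1 : 0 < E.a 1 := E.a_pos 1
  have hWp : 0 < W.period := period_pos W
  have hn : 0 < (E.N (m + 1) : ℝ) / E.N m := by have := E.N_pos m; have := E.N_pos (m + 1); positivity
  set n16 : ℝ := ((E.N (m + 1) : ℝ) / E.N m) ^ (1 / 16 : ℝ) with hn16
  have hn16pos : 0 < n16 := Real.rpow_pos_of_pos hn _
  -- the period formula
  have hP : E.physPeriod (m + 1) = M * W.period / (E.cellVisc (m + 1) * E.a (m + 1)) := physPeriod_eq E.toFractalCarrierData hW (m + 1)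
  -- strain clause and `a 1 ≤ Σ_{i<m} a (i+1)`
  have hstrain : (∑ i ∈ Finset.range m, E.a (i + 1)) * E.refresh (m + 1) ≤ E.θ (m + 1) := hL.2.2.2.2.1 m
  have hsum : E.a 1 ≤ ∑ i ∈ Finset.range m, E.a (i + 1) := by
    have : E.a (0 + 1) ≤ ∑ i ∈ Finset.range m, E.a (i + 1) :=
      Finset.single_le_sum (f := fun i => E.a (i + 1)) (fun i _ => (E.a_pos (i + 1)).le) (Finset.mem_range.2 hm)
    simpa using this
  have hr : 0 < E.refresh (m + 1) := E.refresh_pos (m + 1)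
  -- chain: `a1 · n16 · P ≤ a1 · refresh ≤ Σ a · refresh ≤ θ ≤ θ₀ / n16`
  have h1 : E.a 1 * (n16 * E.physPeriod (m + 1)) ≤ E.θ (m + 1) := by
    calc E.a 1 * (n16 * E.physPeriod (m + 1)) ≤ E.a 1 * E.refresh (m + 1) := mul_le_mul_of_nonneg_left (hT5 m) ha1.le
      _ ≤ (∑ i ∈ Finset.range m, E.a (i + 1)) * E.refresh (m + 1) := mul_le_mul_of_nonneg_right hsum hr.le
      _ ≤ E.θ (m + 1) := hstrain
  have h2 : E.θ (m + 1) ≤ θ₀ / n16 := by rw [le_div_iff₀ hn16pos]; exact hT4 m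
  have h3 : E.a 1 * (n16 * E.physPeriod (m + 1)) * n16 ≤ θ₀ := by
    have := mul_le_mul_of_nonneg_right (h1.trans h2) hn16pos.le
    rwa [div_mul_cancel₀ _ hn16pos.ne'] at this
  -- `n16 · n16 = n^{1/8}`
  have hn8 : n16 * n16 = ((E.N (m + 1) : ℝ) / E.N m) ^ (1 / 8 : ℝ) := by
    rw [hn16, ← Real.rpow_add hn]; norm_num
  -- substitute the period formula and rearrange
  rw [hP] at h3
  have h4 : E.a 1 * (M * W.period) * ((E.N (m + 1) : ℝ) / E.N m) ^ (1 / 8 : ℝ) ≤ θ₀ * (E.cellVisc (m + 1) * E.a (m + 1)) := by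
    have hva : 0 < E.cellVisc (m + 1) * E.a (m + 1) := mul_pos hν ha
    have : E.a 1 * (n16 * (M * W.period / (E.cellVisc (m + 1) * E.a (m + 1)))) * n16
        = E.a 1 * (M * W.period) * (n16 * n16) / (E.cellVisc (m + 1) * E.a (m + 1)) := by
      field_simp
    rw [this, hn8, div_le_iff₀ hva] at h3
    exact h3
  rw [div_mul_eq_mul_div, div_le_iff₀ hθ₀]
  linarith [h4]

/-- Growth of dyadic powers: for `e > 0` and any target `T` there is `m₀` with `T ≤ (2^m)^e` for all `m ≥ m₀`. -/
theorem exists_nat_le_two_pow_rpow {e : ℝ} (he : 0 < e) (T : ℝ) : ∃ m₀ : ℕ, ∀ m, m₀ ≤ m → T ≤ ((2 : ℝ) ^ m) ^ e := by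
  obtain ⟨m₀, hm₀⟩ := exists_nat_ge (T / (e * Real.log 2))
  refine ⟨m₀, fun m hm => ?_⟩
  have hlog : 0 < Real.log 2 := Real.log_pos (by norm_num)
  have h1 : T ≤ (m : ℝ) * (e * Real.log 2) := by
    have : T / (e * Real.log 2) ≤ m := hm₀.trans (by exact_mod_cast hm)
    rwa [div_le_iff₀ (mul_pos he hlog)] at this
  have h2 : ((2 : ℝ) ^ m) ^ e = Real.exp ((m : ℝ) * (e * Real.log 2)) := by
    rw [← Real.rpow_natCast, ← Real.rpow_mul (by norm_num), Real.rpow_def_of_pos (by norm_num)]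
    ring_nf
  rw [h2]
  linarith [Real.add_one_le_exp ((m : ℝ) * (e * Real.log 2))]

/-- `1 − e^{−x} ≥ ¼·min(1, x)` for `x ≥ 0` (from `one_sub_exp_ge_min` at `x/2`, `1 − e^{−2} ≥ 1/2`). -/
theorem one_sub_exp_neg_ge_quarter_min {x : ℝ} (hx : 0 ≤ x) : (1 / 4) * min 1 x ≤ 1 - Real.exp (-x) := by
  have h := one_sub_exp_ge_min (x := x / 2) (by linarith)
  have hx2 : -2 * (x / 2) = -x := by ring
  rw [hx2] at h
  have he2 : (1 : ℝ) / 2 ≤ 1 - Real.exp (-2) := by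
    have : Real.exp (-2) ≤ 1 / 2 := by
      have h3 : (3 : ℝ) ≤ Real.exp 2 := by linarith [Real.add_one_le_exp (2 : ℝ)]
      rw [Real.exp_neg, inv_le_comm₀ (Real.exp_pos _) (by norm_num)]
      rw [one_div, inv_inv]; linarith
    linarith
  have hmin : min 1 x ≤ 2 * min 1 (x / 2) := by
    rcases le_or_gt x 2 with h2 | h2
    · rw [min_eq_right (by linarith : x / 2 ≤ 1)]
      have := min_le_right 1 x; linarith
    · rw [min_eq_left (by linarith : (1:ℝ) ≤ x / 2)]
      have := min_le_left 1 x; linarith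
  have hmin0 : 0 ≤ min 1 (x / 2) := le_min (by norm_num) (by linarith)
  nlinarith

/-- **The trim level and its export (first conjunct of S23″).**  Under the design, `LPermissible`, the template hypotheses (T3)–(T5) and
`N m² ≤ N (m+1)`, for every `R` there is `m⋆` such that for `m ≥ m⋆` the choice `Lc := ⌊ρ^{1/64}·N(m+1)·cellVisc(m+1)/√c⌋₊` satisfies the export
`R ≤ ρ^{1/16}·Lc²·(1 − e^{−4π²·kbar m·lo})` (`Cτ = 1`, `στ = 1/16`), together with the upper bound on `Lc` the lead's confinement bookkeeping uses. -/
theorem trimLevel_export (E : LagrangianLatticeCarrier k) {W : LatticeWord k} {M : ℝ} {hM : 0 < M} (hW : E.design = W.stretch M hM)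
    {c : ℝ} (hc : 0 < c) (hgain : E.gain = c) (hL : E.LPermissible) {θ₀ : ℝ} (hθ₀ : 0 < θ₀)
    (hT4 : ∀ m, E.θ (m + 1) * ((E.N (m + 1) : ℝ) / E.N m) ^ (1 / 16 : ℝ) ≤ θ₀)
    (hT5 : ∀ m, ((E.N (m + 1) : ℝ) / E.N m) ^ (1 / 16 : ℝ) * E.physPeriod (m + 1) ≤ E.refresh (m + 1))
    (hT3 : ∀ m, E.K * ((E.N (m + 1) : ℝ) / E.N m) ^ (1 / 4 : ℝ) ≤ ((E.N (m + 1) : ℝ) / E.N m) * E.cellVisc (m + 1))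
    (hT1 : ∀ m, E.N m ^ 2 ≤ E.N (m + 1)) {lo : ℝ} (hlo : 0 < lo) (R : ℝ) :
    ∃ mstar : ℕ, ∀ m, mstar ≤ m → ∃ Lc : ℕ,
      (Lc : ℝ) ≤ ((E.N m : ℝ) / E.N (m + 1)) ^ (1 / 64 : ℝ) * (E.N (m + 1) * E.cellVisc (m + 1)) / Real.sqrt c ∧
      R ≤ ((E.N m : ℝ) / E.N (m + 1)) ^ (1 / 16 : ℝ) * (Lc : ℝ) ^ 2 * (1 - Real.exp (-(4 * Real.pi ^ 2 * (E.kbar m * lo)))) := by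
  have hP : E.toFractalCarrierData.Permissible := hL.1
  have hK : 0 < E.K := E.K_pos
  have hWp : 0 < W.period := period_pos W
  -- the universal constant of the final bound
  set A : ℝ := (1 / 4) * min (E.K ^ 2 / (4 * c)) (4 * Real.pi ^ 2 * lo * (E.a 1 * (M * W.period) / θ₀) / 4) with hA
  have hApos : 0 < A := by
    have : 0 < E.a 1 * (M * W.period) / θ₀ := by have := E.a_pos 1; positivity
    positivity
  -- three eventual requirements on `m`
  obtain ⟨m₂, hm₂⟩ := exists_nat_le_two_pow_rpow (e := 15 / 64) (by norm_num) (2 * Real.sqrt c / E.K)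
  obtain ⟨m₃, hm₃⟩ := exists_nat_le_two_pow_rpow (e := 1 / 32) (by norm_num) (R / A)
  refine ⟨max 1 (max m₂ m₃), fun m hm => ?_⟩
  have hm1 : 1 ≤ m := le_trans (le_max_left _ _) hm
  have hm2' : m₂ ≤ m := le_trans ((le_max_left _ _).trans (le_max_right _ _)) hm
  have hm3' : m₃ ≤ m := le_trans ((le_max_right _ _).trans (le_max_right _ _)) hm
  -- notation and positivity
  have hNm : (0 : ℝ) < E.N m := by exact_mod_cast E.N_pos m
  have hNm1 : (0 : ℝ) < E.N (m + 1) := by exact_mod_cast E.N_pos (m + 1)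
  set n : ℝ := (E.N (m + 1) : ℝ) / E.N m with hn_def
  set ρ : ℝ := (E.N m : ℝ) / E.N (m + 1) with hρ_def
  have hn : 0 < n := div_pos hNm1 hNm
  have hρ : 0 < ρ := div_pos hNm hNm1
  have hρn : ρ = n⁻¹ := by rw [hρ_def, hn_def, inv_div]
  have hρpow : ∀ e : ℝ, ρ ^ e = n ^ (-e) := fun e => by rw [hρn, Real.inv_rpow hn.le, Real.rpow_neg hn.le]
  set ν : ℝ := E.cellVisc (m + 1) with hν_def
  have hν : 0 < ν := cellVisc_pos' E.toFractalCarrierData (m + 1)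
  -- `n ≥ N m ≥ 2^m`
  have hnN : (E.N m : ℝ) ≤ n := by
    rw [hn_def, le_div_iff₀ hNm]
    have : ((E.N m : ℝ)) ^ 2 ≤ E.N (m + 1) := by exact_mod_cast hT1 m
    nlinarith
  have hn2m : (2 : ℝ) ^ m ≤ n := le_trans (by exact_mod_cast two_pow_le_N E.toFractalCarrierData hP m) hnN
  have hNm_ge1 : (1 : ℝ) ≤ E.N m := by exact_mod_cast E.N_pos m
  have hn1 : 1 ≤ n := hNm_ge1.trans hnN
  -- (T3): `E.K · n^{1/4} / n ≤ ν`, hence `N(m+1)·ν ≥ E.K · N m · n^{1/4} ≥ E.K · n^{1/4}`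
  have hνlow : E.K * n ^ (1 / 4 : ℝ) ≤ n * ν := hT3 m
  have hNν : E.K * n ^ (1 / 4 : ℝ) ≤ (E.N (m + 1) : ℝ) * ν := by
    have h1 : n * ν ≤ (E.N (m + 1) : ℝ) * ν := by
      refine mul_le_mul_of_nonneg_right ?_ hν.le
      rw [hn_def, div_le_iff₀ hNm]; nlinarith
    exact hνlow.trans h1
  -- the trim level
  set Y : ℝ := ρ ^ (1 / 64 : ℝ) * ((E.N (m + 1) : ℝ) * ν) / Real.sqrt c with hY
  have hsc : 0 < Real.sqrt c := Real.sqrt_pos.2 hc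
  have hY0 : 0 ≤ Y := by positivity
  -- `Y ≥ (E.K/√c) · n^{15/64} ≥ 2`
  have hYlow : E.K / Real.sqrt c * n ^ (15 / 64 : ℝ) ≤ Y := by
    rw [hY, hρpow, le_div_iff₀ hsc]
    have h1 : n ^ (-(1 / 64 : ℝ)) * (E.K * n ^ (1 / 4 : ℝ)) ≤ n ^ (-(1 / 64 : ℝ)) * ((E.N (m + 1) : ℝ) * ν) :=
      mul_le_mul_of_nonneg_left hNν (Real.rpow_nonneg hn.le _)
    have h2 : n ^ (-(1 / 64 : ℝ)) * (E.K * n ^ (1 / 4 : ℝ)) = E.K * n ^ (15 / 64 : ℝ) := by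
      rw [show (15 / 64 : ℝ) = -(1 / 64) + 1 / 4 by norm_num, Real.rpow_add hn]; ring
    calc E.K / Real.sqrt c * n ^ (15 / 64 : ℝ) * Real.sqrt c = E.K * n ^ (15 / 64 : ℝ) := by field_simp
      _ = n ^ (-(1 / 64 : ℝ)) * (E.K * n ^ (1 / 4 : ℝ)) := h2.symm
      _ ≤ n ^ (-(1 / 64 : ℝ)) * ((E.N (m + 1) : ℝ) * ν) := h1
  have hY2 : 2 ≤ Y := by
    have h1 : 2 * Real.sqrt c / E.K ≤ ((2 : ℝ) ^ m) ^ (15 / 64 : ℝ) := hm₂ m hm2'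
    have h2 : ((2 : ℝ) ^ m) ^ (15 / 64 : ℝ) ≤ n ^ (15 / 64 : ℝ) := Real.rpow_le_rpow (by positivity) hn2m (by norm_num)
    have h3 : 2 * Real.sqrt c / E.K ≤ n ^ (15 / 64 : ℝ) := h1.trans h2
    have h4 : 2 ≤ E.K / Real.sqrt c * n ^ (15 / 64 : ℝ) := by
      rw [div_le_iff₀ hK] at h3
      calc (2 : ℝ) = (2 * Real.sqrt c) / Real.sqrt c := by field_simp
        _ ≤ (n ^ (15 / 64 : ℝ) * E.K) / Real.sqrt c := div_le_div_of_nonneg_right h3 hsc.le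
        _ = E.K / Real.sqrt c * n ^ (15 / 64 : ℝ) := by ring
    exact h4.trans hYlow
  set Lc : ℕ := ⌊Y⌋₊ with hLc
  have hLcY : (Lc : ℝ) ≤ Y := Nat.floor_le hY0
  have hLc2 : Y / 2 ≤ Lc := by
    have : Y < (Lc : ℝ) + 1 := Nat.lt_floor_add_one Y
    linarith
  have hLc0 : 0 ≤ (Lc : ℝ) := Nat.cast_nonneg _
  refine ⟨Lc, hLcY, ?_⟩
  -- `Lc² ≥ Y²/4 = ρ^{1/32} (N ν)² / (4c)`
  have hLsq : Y ^ 2 / 4 ≤ (Lc : ℝ) ^ 2 := by nlinarith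
  have hYsq : Y ^ 2 = n ^ (-(1 / 32 : ℝ)) * ((E.N (m + 1) : ℝ) * ν) ^ 2 / c := by
    rw [hY, div_pow, mul_pow, Real.sq_sqrt hc.le, hρpow, ← Real.rpow_natCast (n ^ (-(1/64:ℝ))) 2, ← Real.rpow_mul hn.le]
    norm_num
  -- (L2) `Lc² ≥ (E.K²/(4c)) · n^{15/32} ≥ (E.K²/(4c)) · n^{3/32}`
  have hL2 : E.K ^ 2 / (4 * c) * n ^ (3 / 32 : ℝ) ≤ (Lc : ℝ) ^ 2 := by
    have h1 : (E.K * n ^ (1 / 4 : ℝ)) ^ 2 ≤ ((E.N (m + 1) : ℝ) * ν) ^ 2 :=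
      pow_le_pow_left₀ (by positivity) hNν 2
    have h2 : (E.K * n ^ (1 / 4 : ℝ)) ^ 2 = E.K ^ 2 * n ^ (1 / 2 : ℝ) := by
      rw [mul_pow, ← Real.rpow_natCast (n ^ (1/4:ℝ)) 2, ← Real.rpow_mul hn.le]; norm_num
    have h3 : n ^ (3 / 32 : ℝ) ≤ n ^ (15 / 32 : ℝ) := Real.rpow_le_rpow_of_exponent_le hn1 (by norm_num)
    have h4 : n ^ (-(1 / 32 : ℝ)) * (E.K ^ 2 * n ^ (1 / 2 : ℝ)) = E.K ^ 2 * n ^ (15 / 32 : ℝ) := by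
      rw [show (15 / 32 : ℝ) = -(1 / 32) + 1 / 2 by norm_num, Real.rpow_add hn]; ring
    calc E.K ^ 2 / (4 * c) * n ^ (3 / 32 : ℝ) ≤ E.K ^ 2 / (4 * c) * n ^ (15 / 32 : ℝ) :=
          mul_le_mul_of_nonneg_left h3 (by positivity)
      _ = (n ^ (-(1 / 32 : ℝ)) * (E.K * n ^ (1 / 4 : ℝ)) ^ 2 / c) / 4 := by rw [h2, h4]; ring
      _ ≤ (n ^ (-(1 / 32 : ℝ)) * ((E.N (m + 1) : ℝ) * ν) ^ 2 / c) / 4 := by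
          gcongr
      _ = Y ^ 2 / 4 := by rw [hYsq]
      _ ≤ (Lc : ℝ) ^ 2 := hLsq
  -- (L1) `Lc² · kbar m ≥ (a1 M Wp/(4θ₀)) · n^{3/32}`
  have hkb : E.kbar (m + 1) * (c / ν ^ 2) ≤ E.kbar m := by
    have := kbar_ge_gain_div E.toFractalCarrierData hP m
    rwa [hgain] at this
  have hkN : E.kbar (m + 1) * (E.N (m + 1) : ℝ) ^ 2 = E.a (m + 1) * ν := kbar_mul_N_sq E.toFractalCarrierData (m + 1)
  have hνa : (E.a 1 * (M * W.period) / θ₀) * n ^ (1 / 8 : ℝ) ≤ ν * E.a (m + 1) := cellVisc_mul_a_ge E hW hL hθ₀ hT4 hT5 hm1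
  have hL1 : (E.a 1 * (M * W.period) / θ₀ / 4) * n ^ (3 / 32 : ℝ) ≤ (Lc : ℝ) ^ 2 * E.kbar m := by
    -- `Lc² kbar_m ≥ (Y²/4)·kbar_{m+1} c/ν² = n^{-1/32} N² ν² kbar_{m+1} /(4ν²) = n^{-1/32} a ν /4`
    have h1 : (Lc : ℝ) ^ 2 * (E.kbar (m + 1) * (c / ν ^ 2)) ≤ (Lc : ℝ) ^ 2 * E.kbar m := mul_le_mul_of_nonneg_left hkb (sq_nonneg _)
    have h2 : Y ^ 2 / 4 * (E.kbar (m + 1) * (c / ν ^ 2)) ≤ (Lc : ℝ) ^ 2 * (E.kbar (m + 1) * (c / ν ^ 2)) :=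
      mul_le_mul_of_nonneg_right hLsq (by have := E.kbar_pos (m + 1); positivity)
    have h3 : Y ^ 2 / 4 * (E.kbar (m + 1) * (c / ν ^ 2)) = n ^ (-(1 / 32 : ℝ)) * (ν * E.a (m + 1)) / 4 := by
      rw [hYsq]
      have hνne : ν ≠ 0 := hν.ne'
      have hcne : c ≠ 0 := hc.ne'
      field_simp
      rw [mul_comm, hkN, mul_comm]
    have h4 : n ^ (-(1 / 32 : ℝ)) * ((E.a 1 * (M * W.period) / θ₀) * n ^ (1 / 8 : ℝ)) / 4
        ≤ n ^ (-(1 / 32 : ℝ)) * (ν * E.a (m + 1)) / 4 := by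
      gcongr
    have h5 : n ^ (-(1 / 32 : ℝ)) * ((E.a 1 * (M * W.period) / θ₀) * n ^ (1 / 8 : ℝ)) / 4
        = (E.a 1 * (M * W.period) / θ₀ / 4) * n ^ (3 / 32 : ℝ) := by
      rw [show (3 / 32 : ℝ) = -(1 / 32) + 1 / 8 by norm_num, Real.rpow_add hn]; ring
    calc (E.a 1 * (M * W.period) / θ₀ / 4) * n ^ (3 / 32 : ℝ) = _ := h5.symm
      _ ≤ _ := h4
      _ = Y ^ 2 / 4 * (E.kbar (m + 1) * (c / ν ^ 2)) := h3.symm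
      _ ≤ _ := h2
      _ ≤ (Lc : ℝ) ^ 2 * E.kbar m := h1
  -- `1 − e^{−x} ≥ ¼ min(1, x)` with `x = 4π² kbar_m lo`
  set x : ℝ := 4 * Real.pi ^ 2 * (E.kbar m * lo) with hx
  have hx0 : 0 ≤ x := by have := E.kbar_pos m; positivity
  have hex : (1 / 4) * min 1 x ≤ 1 - Real.exp (-x) := one_sub_exp_neg_ge_quarter_min hx0
  -- `Lc² (1 − e^{−x}) ≥ ¼ min(Lc², Lc² x) ≥ A · n^{3/32}`
  have hmain : A * n ^ (3 / 32 : ℝ) ≤ (Lc : ℝ) ^ 2 * (1 - Real.exp (-x)) := by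
    have hn332 : 0 ≤ n ^ (3 / 32 : ℝ) := Real.rpow_nonneg hn.le _
    have h1 : (Lc : ℝ) ^ 2 * ((1 / 4) * min 1 x) ≤ (Lc : ℝ) ^ 2 * (1 - Real.exp (-x)) := mul_le_mul_of_nonneg_left hex (sq_nonneg _)
    have h2 : A * n ^ (3 / 32 : ℝ) ≤ (Lc : ℝ) ^ 2 * ((1 / 4) * min 1 x) := by
      set B : ℝ := 4 * Real.pi ^ 2 * lo * (E.a 1 * (M * W.period) / θ₀) / 4 with hB
      have hB3 : B * n ^ (3 / 32 : ℝ) ≤ (Lc : ℝ) ^ 2 * x := by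
        have := mul_le_mul_of_nonneg_left hL1 (by positivity : (0:ℝ) ≤ 4 * Real.pi ^ 2 * lo)
        have h' : 4 * Real.pi ^ 2 * lo * ((E.a 1 * (M * W.period) / θ₀ / 4) * n ^ (3 / 32 : ℝ)) = B * n ^ (3 / 32 : ℝ) := by
          rw [hB]; ring
        have h'' : 4 * Real.pi ^ 2 * lo * ((Lc : ℝ) ^ 2 * E.kbar m) = (Lc : ℝ) ^ 2 * x := by rw [hx]; ring
        linarith [this, h', h'']
      rcases le_total 1 x with h1x | hx1
      · rw [min_eq_left h1x]
        have hAle : A ≤ (1 / 4) * (E.K ^ 2 / (4 * c)) := by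
          rw [hA]; exact mul_le_mul_of_nonneg_left (min_le_left _ _) (by norm_num)
        calc A * n ^ (3 / 32 : ℝ) ≤ (1 / 4) * (E.K ^ 2 / (4 * c)) * n ^ (3 / 32 : ℝ) := mul_le_mul_of_nonneg_right hAle hn332
          _ = (1 / 4) * (E.K ^ 2 / (4 * c) * n ^ (3 / 32 : ℝ)) := by ring
          _ ≤ (1 / 4) * (Lc : ℝ) ^ 2 := mul_le_mul_of_nonneg_left hL2 (by norm_num)
          _ = (Lc : ℝ) ^ 2 * ((1 / 4) * 1) := by ring
      · rw [min_eq_right hx1]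
        have hAle : A ≤ (1 / 4) * B := by
          rw [hA]; exact mul_le_mul_of_nonneg_left (min_le_right _ _) (by norm_num)
        calc A * n ^ (3 / 32 : ℝ) ≤ (1 / 4) * B * n ^ (3 / 32 : ℝ) := mul_le_mul_of_nonneg_right hAle hn332
          _ = (1 / 4) * (B * n ^ (3 / 32 : ℝ)) := by ring
          _ ≤ (1 / 4) * ((Lc : ℝ) ^ 2 * x) := mul_le_mul_of_nonneg_left hB3 (by norm_num)
          _ = (Lc : ℝ) ^ 2 * ((1 / 4) * x) := by ring
    exact h2.trans h1
  -- the `ρ^{1/16}` factor: `ρ^{1/16} n^{3/32} = n^{1/32} ≥ (2^m)^{1/32} ≥ R/A`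
  have hfin : R ≤ ρ ^ (1 / 16 : ℝ) * (A * n ^ (3 / 32 : ℝ)) := by
    have h1 : ρ ^ (1 / 16 : ℝ) * (A * n ^ (3 / 32 : ℝ)) = A * n ^ (1 / 32 : ℝ) := by
      rw [hρpow, show (1 / 32 : ℝ) = -(1 / 16) + 3 / 32 by norm_num, Real.rpow_add hn]; ring
    have h2 : R / A ≤ n ^ (1 / 32 : ℝ) :=
      (hm₃ m hm3').trans (Real.rpow_le_rpow (by positivity) hn2m (by norm_num))
    rw [h1]
    rw [div_le_iff₀ hApos] at h2
    linarith
  calc R ≤ ρ ^ (1 / 16 : ℝ) * (A * n ^ (3 / 32 : ℝ)) := hfin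
    _ ≤ ρ ^ (1 / 16 : ℝ) * ((Lc : ℝ) ^ 2 * (1 - Real.exp (-x))) :=
        mul_le_mul_of_nonneg_left hmain (Real.rpow_nonneg hρ.le _)
    _ = ρ ^ (1 / 16 : ℝ) * (Lc : ℝ) ^ 2 * (1 - Real.exp (-x)) := by ring

end Summit.AnomalousDissipation.AnomalousDissipation.Theorems.SolenoidalFractalHomogenisation.LagrangianStep
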